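import Mathlib
import Summits.Ventures.PercRepro2.PMK5Deg5LocusCoverA

/-!
# THE TWO COVERINGS OF THE EDGE SETS OF `K₆` — PART B: THE CHUNKS `4 … 7`, THE ASSEMBLY, `coverPos`, `coverZero`
(blind cell PercRepro2, mine-2 g32; on `PMK5Deg5LocusCoverA.lean`: the down-set property `fiveClass15_mono`,
`fiveClass_WW`, `fiveClass_MX`, the chunks `0 … 3`)

**`coverAll`**: every edge set of `K₆` contains one of the fifty witness supports `WW` or lies inside one of the
fourteen maximal faces `MX` (eight `decide +kernel` over `4096` masks each, bitmask inclusions `a &&& b = a` only);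
**`coverPos`** — a non-degenerate edge set contains a witness support (it cannot lie in a degenerate face, by the
down-set property) — and **`coverZero`** — a degenerate edge set lies inside a maximal face (it cannot contain a
non-degenerate support).  Standard axioms.
-/

namespace Summit.Ventures.PercRepro2

namespace Deg5

namespace Locus

set_option maxHeartbeats 0 in
set_option maxRecDepth 100000 in
/-- The covering on the masks `16384 … 20479`. -/
theorem coverAll4 : ∀ m : Fin 4096,
    (∃ i : Fin 50, WW i &&& ((m : ℕ) + 16384) = WW i) ∨
      (∃ j : Fin 14, ((m : ℕ) + 16384) &&& MX j = (m : ℕ) + 16384) := by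
  decide +kernel

set_option maxHeartbeats 0 in
set_option maxRecDepth 100000 in
/-- The covering on the masks `20480 … 24575`. -/
theorem coverAll5 : ∀ m : Fin 4096,
    (∃ i : Fin 50, WW i &&& ((m : ℕ) + 20480) = WW i) ∨
      (∃ j : Fin 14, ((m : ℕ) + 20480) &&& MX j = (m : ℕ) + 20480) := by
  decide +kernel

set_option maxHeartbeats 0 in
set_option maxRecDepth 100000 in
/-- The covering on the masks `24576 … 28671`. -/
theorem coverAll6 : ∀ m : Fin 4096,
    (∃ i : Fin 50, WW i &&& ((m : ℕ) + 24576) = WW i) ∨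
      (∃ j : Fin 14, ((m : ℕ) + 24576) &&& MX j = (m : ℕ) + 24576) := by
  decide +kernel

set_option maxHeartbeats 0 in
set_option maxRecDepth 100000 in
/-- The covering on the masks `28672 … 32767`. -/
theorem coverAll7 : ∀ m : Fin 4096,
    (∃ i : Fin 50, WW i &&& ((m : ℕ) + 28672) = WW i) ∨
      (∃ j : Fin 14, ((m : ℕ) + 28672) &&& MX j = (m : ℕ) + 28672) := by
  decide +kernel

/-- **Every edge set of `K₆` contains a witness support or lies inside a maximal face** (eight `decide +kernel`
over `4096` masks each, bitmask inclusions only). -/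
theorem coverAll (m : ℕ) (hm : m < 32768) :
    (∃ i : Fin 50, WW i &&& m = WW i) ∨ (∃ j : Fin 14, m &&& MX j = m) := by
  have hq : m / 4096 < 8 := by omega
  interval_cases h : m / 4096
  · rw [show m = (m - 0) + 0 by omega]
    exact coverAll0 ⟨m - 0, by omega⟩
  · rw [show m = (m - 4096) + 4096 by omega]
    exact coverAll1 ⟨m - 4096, by omega⟩
  · rw [show m = (m - 8192) + 8192 by omega]
    exact coverAll2 ⟨m - 8192, by omega⟩
  · rw [show m = (m - 12288) + 12288 by omega]
    exact coverAll3 ⟨m - 12288, by omega⟩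
  · rw [show m = (m - 16384) + 16384 by omega]
    exact coverAll4 ⟨m - 16384, by omega⟩
  · rw [show m = (m - 20480) + 20480 by omega]
    exact coverAll5 ⟨m - 20480, by omega⟩
  · rw [show m = (m - 24576) + 24576 by omega]
    exact coverAll6 ⟨m - 24576, by omega⟩
  · rw [show m = (m - 28672) + 28672 by omega]
    exact coverAll7 ⟨m - 28672, by omega⟩

/-- **The positive covering**: every non-degenerate edge set contains a witness support. -/
theorem coverPos (m : ℕ) (hm : m < 32768) (hr : FiveClass15 m = false) :
    ∃ i : Fin 50, ∀ e : Fin 15, (WW i).testBit e = true → m.testBit e = true := by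
  rcases coverAll m hm with ⟨i, hi⟩ | ⟨j, hj⟩
  · exact ⟨i, testBit_of_land hi⟩
  · have := fiveClass15_mono (testBit_of_land hj) (fiveClass_MX j)
    rw [hr] at this
    exact absurd this Bool.false_ne_true

/-- **The zero covering**: every degenerate edge set lies inside a maximal face. -/
theorem coverZero (m : ℕ) (hm : m < 32768) (hr : FiveClass15 m = true) :
    ∃ j : Fin 14, ∀ e : Fin 15, m.testBit e = true → (MX j).testBit e = true := by
  rcases coverAll m hm with ⟨i, hi⟩ | ⟨j, hj⟩
  · have := fiveClass15_mono (testBit_of_land hi) hr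
    rw [fiveClass_WW i] at this
    exact absurd this Bool.false_ne_true
  · exact ⟨j, testBit_of_land hj⟩

end Locus

end Deg5

end Summit.Ventures.PercRepro2
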